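import Summits.HodgeConjecture.HodgeConjecture.Theorems.F0P6aStubEHECKEStageB
import HarnessLib

/-!
# `F0P6aStubEHECKE` — ★ RE-HOME of `Lines/F0_P6a_StubEHECKE.lean`, PART 6 of 6 (size-lint split; cut at a declaration boundary).

## Import provenance
- `Theorems.F0P6aStubEHECKEStageB` = ★ previous part of the same `Lines` workfile `F0_P6a_StubEHECKE` (size-lint split ×6); `HarnessLib`.

See PART 1 `Theorems/F0P6aStubEHECKESocket.lean` for the full re-home header and the original module docstring (verbatim there). Namespaces and sections KEPT
(re-opened below exactly as they stand at the cut, with their `open`∕`variable` lines replayed); code bytes = the workfile՚s, docstrings included; options preamble repeated from PART 1.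
HC_CM is proved only modulo the 7 printed citations (2 remaining: hLiu418 = stmt-HodgeConjecture-24832, h413 = stmt-HodgeConjecture-24833) until rung 0 closes; a re-home is count-neutral. -/

set_option autoImplicit false

noncomputable section

namespace Summit.HodgeConjecture.HodgeConjecture.Cruxes.HLiu418.F0P6aStubEHECKE
set_option linter.dupNamespace false
open CategoryTheory CategoryTheory.Limits NumberField IsDedekindDomain MulAction AlgebraicGeometry
open scoped Matrix Polynomial Pointwise
open Literature.NumberTheory.GaloisRepresentations
open Literature.NumberTheory.Automorphic Literature.NumberTheory.Automorphic.UnitaryGroup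
open Literature.AlgebraicGeometry.ShimuraVarieties Literature.AlgebraicGeometry.ShimuraVarieties.UnitaryCanonicalModel
open Literature.NumberTheory.Automorphic.Liu2021.AppendixC
open Literature.AlgebraicGeometry.Motives (AlgPoints ComplexPoints SchemeOver thickeningLift specOver)
open Literature.AlgebraicGeometry.Motives.AbelianVariety (bcSpec)
open Literature.AlgebraicGeometry.AbelianSchemes (PolarizedAbelianSchemeWithLevel AbelianSchemeOver)
open Literature.AlgebraicGeometry.ModuliOfAbelianVarieties
open Summit.HodgeConjecture.HodgeConjecture.Cruxes.HLiu418.F0P6aPELWitnessE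
open Summit.HodgeConjecture.HodgeConjecture.Cruxes.HLiu418.F0P6aStubE6 (RingActionReading Reads)
open Summit.HodgeConjecture.HodgeConjecture.Cruxes.HLiu418.F0P6aEReadings (EHeckeAt HeckeRoofsE RoofE schEOf fibreEOf dualEOf polEOf lvlPtEOf actEOf IsIdealTorsionE)
open Literature.AlgebraicGeometry.AbelianSchemes.AbelianSchemeOver (fibreHom RingAction exists_pointsAlong_mulEquiv_of_eq pointsAlong_map_of_eq
  pointsAlong_forall_map_eq_one_iff_of_eq roof_readAt_comp_of_eq)
open Summit.HodgeConjecture.HodgeConjecture.Cruxes.HLiu418.F0P6aModuliDatumDefs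
open Summit.HodgeConjecture.HodgeConjecture.Cruxes.HLiu418.F0P6aRGDAssembly
open Literature.AlgebraicGeometry.Motives (CMType)
open Literature.AlgebraicGeometry.ShimuraVarieties.UnitaryCanonicalModel.Aux (ratBasis torusFinAdelic)
open Literature.AlgebraicGeometry.ShimuraVarieties.UnitaryCurve Literature.AlgebraicGeometry.ShimuraVarieties.UnitaryCurve.AuxV
open Literature.NumberTheory.ComplexMultiplication.CMTypeOps (flip bar)
open Literature.Geometry.Kaehler (ComplexTorus)
open Summit.HodgeConjecture.HodgeConjecture.Cruxes.HLiu418.F0P6aChartFramePin (IsChartOfFrame)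


set_option maxHeartbeats 400000 in
/-- **ORGAN (O-R2) `OrganER2` — THE `t₂`-HALF AT COMPLEX POINTS (CENTRAL ROOFS).**  Same context; for every representative system `rc₂` of `Kc t₂ Kc ∕ Kc` (the central
translate `⟨ϖ_w⟩`): `T_{rc₂β₂} x′` is a roof neighbour of `ℓ x′` through the whole `𝔭_{c•w}`-torsion (`HeckeCentralRoofsAt` at `Ω := ℂ`).  ROAD: as (O-R1) without lines —
`t₂` central ⇒ `𝔭_w⁻¹Λ_{b(a₀ t₂)} = 𝔭_{c•w}⁻¹Λ_{b a₀}` ((L-d =), FILE B), `K₂ = A_y[𝔭_{c•w}]`, middle `B = A_y ∕ A_y[𝔭_{c•w}] ≅ A_{y″} ⊗ 𝔭_w⁻¹` (★ Serre tensor ∕ isogeny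
quotient), (r3) by `h^∨ ∘ λ₂ ∘ h = p² λ₁` + ★ `DualIsogenyConjCancel`.  = LA4-plan (g0) DEAL #20 «(H-E)-CENTRAL» (LA4-p01 (g2)) re-addressed to complex points.  A genuine
lemma (size M–L).  NOT asserted by declaring it. (print: RapoportSmithlingZhang2020Diagonal, §4.3 (4.23) p. 21) (print: Kottwitz1992, §5 pp. 389–391) (print: MumfordAV1970, §23 Thm. 2 p. 231) -/
def OrganER2 : Prop :=
  ∀ (F : Type) [Field F] [NumberField F] [IsCMField F] [IsGalois ℚ F] (ι₁ : F →+* ℂ)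
    (Jstar : Matrix (Fin 2) (Fin 2) F) (hJ : (Jstar.map (IsCMField.complexConj F))ᵀ = Jstar) (hJu : IsUnit Jstar)
    (K₀ : C5.OpenCompactSubgroup (GSAdele F Jstar)) (S : RecordSystemGS F Jstar ι₁ K₀) (hU7ₛ : S.HeckeTranslateDefinedOver) (Kc : C5.SmallLevel K₀)
    (Fi : Type) [Field Fi] [NumberField Fi] [Algebra F Fi] [IsGalois F Fi] (τE : Fi →+* ℂ) (hτE : τE.comp (algebraMap F Fi) = ι₁)
    (Φ : Set (F →+* ℂ)) (hΦ : IsCMTypeThrough ι₁ Φ) (C : AuxChartGS F ι₁ Jstar K₀ S Kc Fi τE Φ)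
    (ξ : F) (k : ℕ) (Fr : SymplecticFrameV F (RingHom.id F) Jstar ((k : ℚ) • ξ) C.g C.δ) (_hpin : IsChartOfFrame hΦ C ξ k Fr)
    (ε : (Literature.AlgebraicGeometry.Motives.baseChange F Fi).obj (S.M.obj Kc) ⟶
        (Literature.AlgebraicGeometry.Motives.baseChange ℚ Fi).obj C.𝓜.M)
    (_hε : letI : Algebra Fi ℂ := τE.toAlgebra
      ∀ (P : ComplexPoints ((Literature.AlgebraicGeometry.Motives.baseChange F Fi).obj (S.M.obj Kc)))
        (Pflat : letI : Algebra F ℂ := ι₁.toAlgebra; ComplexPoints (S.M.obj Kc)),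
        Pflat.left = P.left ≫ pullback.fst (S.M.obj Kc).hom (bcSpec F Fi) →
        (AlgPoints.map ε P).left ≫ pullback.fst C.𝓜.M.hom (bcSpec ℚ Fi) =
          (letI : Algebra F ℂ := ι₁.toAlgebra; (C.f (S.pts Kc Pflat)).left))
    (ρ : AbelianSchemeOver.RingAction (𝓞 F) (C.𝓜.univ.baseChange (ε.left ≫ pullback.fst C.𝓜.M.hom (bcSpec ℚ Fi))).A),
    RingActionReading C ε ρ →
    ∀ (w : HeightOneSpectrum (𝓞 F)) (hw : (IsCMField.complexConj F) • w ≠ w),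
      UnitaryGroup.IsHyperspecialAt ↥(maximalRealSubfield F) F (IsCMField.complexConj F) 2 Jstar Kc.1.1
          (w.under (𝓞 ↥(maximalRealSubfield F))) →
      (UnitaryGroup.isUnit_placeForm Jstar hJu w).unit ∈ glInt 2 (w.adicCompletion F) →
      ∀ (pChar fDeg : ℕ), Nat.Prime pChar → (pChar : 𝓞 F) ∈ w.asIdeal →
        Nat.card (𝓞 F ⧸ ((IsCMField.complexConj F) • w).asIdeal) = pChar ^ fDeg → ¬ pChar ∣ C.N →
        ∀ (N' : C5.SmallLevel K₀) (hN'Kc : N' ≤ Kc)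
        (rc₂ : orbit (Kc.1.1 : Subgroup ↥(finAdelic ↥(maximalRealSubfield F) F (IsCMField.complexConj F) 2 Jstar))
             ((UnitaryGroup.heckeElementAt ↥(maximalRealSubfield F) F (IsCMField.complexConj F) 2 Jstar
                 (⟨w, rfl⟩ : UnitaryGroup.PlacesOver F (w.under (𝓞 ↥(maximalRealSubfield F))))
                 (IsCMField.complexConj_ne_one F) hJ hw (UnitaryGroup.isUnit_placeForm Jstar hJu w) (HeckeCharacter.uniformizer F w) 2 :
               ↥(finAdelic ↥(maximalRealSubfield F) F (IsCMField.complexConj F) 2 Jstar)) :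
               ↥(finAdelic ↥(maximalRealSubfield F) F (IsCMField.complexConj F) 2 Jstar) ⧸
                 (Kc.1.1 : Subgroup ↥(finAdelic ↥(maximalRealSubfield F) F (IsCMField.complexConj F) 2 Jstar))) →
           ↥(finAdelic ↥(maximalRealSubfield F) F (IsCMField.complexConj F) 2 Jstar))
        (hrc₂ : ∀ β, ((rc₂ β : ↥(finAdelic ↥(maximalRealSubfield F) F (IsCMField.complexConj F) 2 Jstar)) :
            ↥(finAdelic ↥(maximalRealSubfield F) F (IsCMField.complexConj F) 2 Jstar) ⧸
              (Kc.1.1 : Subgroup ↥(finAdelic ↥(maximalRealSubfield F) F (IsCMField.complexConj F) 2 Jstar))) = β.1)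
        (hrcN₂ : ∀ β, C5.HeckeLE (rc₂ β) N' Kc)
        (x'c : letI : Algebra F ℂ := ι₁.toAlgebra; AlgPoints (S.M.obj N') ℂ),
        letI : Algebra F ℂ := ι₁.toAlgebra
        letI P := C.𝓜.univ.baseChange (ε.left ≫ pullback.fst C.𝓜.M.hom (bcSpec ℚ Fi))
        HeckeCentralRoofsAt S hU7ₛ hJ hJu Kc w hw P.A ρ P.D P.pol P.level pChar fDeg (sheetHom ι₁ τE hτE) N' hN'Kc rc₂ hrcN₂ x'c


set_option maxHeartbeats 400000 in
/-- **(O-R2) JUNCTION (L5-#7, LA5-p01 (g4)) — `OrganMP → OrganER2`: the central roofs at complex points from the marked pair of the central Hecke translate (STAGE A once, STAGE B at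
`i := 2`, `t := rc₂ β₂`) and ★ `exists_heckeCentralRoof_of_markedReadings` (A-p06 (g35), p850307), fed with the E-side facts: `c := conj|𝓞F` (`hcc`), `𝔭_w.map c = 𝔭_{c•w}`,
`𝔭_w 𝔭_{c•w} 𝔡 = (p)`, Rosati from L6 `rosatiOver_of_ringActionReading`, `hrel := P.relDim`, `uᵢ := C.u (pieceᵢ)` (`C.rep_spec`).
[cite: Kottwitz1992, §5 pp. 389–391] [cite: RapoportSmithlingZhang2020Diagonal, §4.3 (4.23) p. 21] [cite: HarrisTaylorAMS2001, §III.4, pp. 108–110] -/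
theorem stub_ER2_of_MP (hMP : OrganMP) : OrganER2 := by
  intro F _ _ _ _ ι₁ Jstar hJ hJu K₀ S hU7ₛ Kc Fi _ _ _ _ τE hτE Φ hΦ C ξ k Fr hpin ε hε ρ hR w hw hKv hJi pChar fDeg hp hpw hq hpN
    N' hN'Kc rc₂ hrc₂ hrcN₂ x'c
  letI : Algebra F ℂ := ι₁.toAlgebra
  letI : Algebra Fi ℂ := τE.toAlgebra
  intro β₂
  -- (O-MP) STAGE A at `x′` (opened with `Exists.elim` + projections, n3-cure), STAGE B at `i := 2`, `t := rc₂ β₂`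
  refine (hMP F ι₁ Jstar hJ hJu K₀ S hU7ₛ Kc Fi τE hτE Φ hΦ C ξ k Fr hpin ε hε ρ hR N' hN'Kc x'c).elim fun v h => h.elim fun hv h =>
    h.elim fun a' h => h.elim fun v₁ h => h.elim fun hv₁ h => h.elim fun a₁ h => h.elim fun q₁ h => h.elim fun m₁ h =>
    h.elim fun Θ₁ h => h.elim fun Λ₁ hA => ?_
  have hR₁ := hA.2.2.2.1
  have hMJ₁ := hA.2.2.2.2.1
  have ht : ((rc₂ β₂ : GSAdele F Jstar) : GSAdele F Jstar ⧸ (Kc.1.1 : Subgroup (GSAdele F Jstar))) ∈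
      orbit (Kc.1.1 : Subgroup (GSAdele F Jstar))
        ((UnitaryGroup.heckeElementAt ↥(maximalRealSubfield F) F (IsCMField.complexConj F) 2 Jstar
            (⟨w, rfl⟩ : UnitaryGroup.PlacesOver F (w.under (𝓞 ↥(maximalRealSubfield F))))
            (IsCMField.complexConj_ne_one F) hJ hw (UnitaryGroup.isUnit_placeForm Jstar hJu w) (HeckeCharacter.uniformizer F w) 2 :
          GSAdele F Jstar) : GSAdele F Jstar ⧸ (Kc.1.1 : Subgroup (GSAdele F Jstar))) := by
    rw [hrc₂ β₂]; exact β₂.2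
  refine (hA.2.2.2.2.2 w hw hKv hJi 2 (rc₂ β₂) ht (hrcN₂ β₂)).elim fun v₂ h => h.elim fun hv₂ h => h.elim fun a₂ h =>
    h.elim fun q₂ h => h.elim fun m₂ h => h.elim fun Θ₂ h => h.elim fun Λ₂ hB => ?_
  have hR₂ := hB.2.2.1
  have hTJ := hB.2.2.2.2.1
  have hTM := hB.2.2.2.2.2.1
  have hTν := hB.2.2.2.2.2.2.1
  have hTΛ := hB.2.2.2.2.2.2.2.1
  have hTΛc := hB.2.2.2.2.2.2.2.2.2.1 rfl
  have hTlvl := hB.2.2.2.2.2.2.2.2.2.2 pChar hp hpw hpN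
  -- E-SIDE FACTS: `c := conj|𝓞F`, `hcc`, `𝔭_w.map c = 𝔭_{c•w}`, `𝔭_w·𝔭_{c•w}·𝔡 = (p)`, Rosati (L6), `N ≠ 0`, the principal units `uᵢ`
  let c : 𝓞 F ≃+* 𝓞 F :=
    MulSemiringAction.toRingEquiv (F ≃ₐ[↥(maximalRealSubfield F)] F) (𝓞 F) (IsCMField.complexConj F)
  have hc : ∀ y : 𝓞 F, ((c y : 𝓞 F) : F) = IsCMField.complexConj F (y : F) := fun y => rfl
  have hcc : ∀ y, c (c y) = y := fun y => RingOfIntegers.ext <| by rw [hc, hc, IsCMField.complexConj_apply_apply]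
  have h𝔭c : w.asIdeal.map (c : 𝓞 F →+* 𝓞 F) = ((IsCMField.complexConj F) • w).asIdeal := by
    rw [Literature.NumberTheory.Automorphic.HeightOneSpectrum.smul_asIdeal, Ideal.pointwise_smul_def]
    rfl
  have hp' : (pChar : 𝓞 F) ∈ ((IsCMField.complexConj F) • w).asIdeal := by
    rw [← h𝔭c, ← map_natCast (c : 𝓞 F →+* 𝓞 F) pChar]
    exact Ideal.mem_map_of_mem _ hpw
  have hne : w.asIdeal ≠ ((IsCMField.complexConj F) • w).asIdeal := fun h => hw (HeightOneSpectrum.ext h.symm)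
  obtain ⟨𝔡, h𝔡⟩ := (Ideal.isCoprime_iff_sup_eq.2
    (Ideal.IsMaximal.coprime_of_ne w.isMaximal ((IsCMField.complexConj F) • w).isMaximal hne)).mul_dvd
    ((Ideal.dvd_iff_le).2 ((Ideal.span_singleton_le_iff_mem _).2 hpw))
    ((Ideal.dvd_iff_le).2 ((Ideal.span_singleton_le_iff_mem _).2 hp'))
  have hN : C.N ≠ 0 := by have := C.hN; omega
  have hsp₁ := C.rep_spec (C.piece a₁)
  have hsp₂ := C.rep_spec (C.piece a₂)
  have hTu : IsUnit ((((q₂⁻¹ * q₁ : ↥(gspRational C.δ)) : GL (Fin C.g ⊕ Fin C.g) ℚ) :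
      Matrix (Fin C.g ⊕ Fin C.g) (Fin C.g ⊕ Fin C.g) ℚ)) := Units.isUnit _
  -- THE CENTRAL ROOF (★ A-p06 (g35) p850307), read back through the §1 readers (`schAt`∕`fibreAt`∕`dualAt`∕`polAt` abbrevs, `lvlPtAt`∕`actAt`∕`IsIdealTorsionAt` δ)
  exact Literature.AlgebraicGeometry.ModuliOfAbelianVarieties.exists_heckeCentralRoof_of_markedReadings _ ρ _ _ _ hN
    (C.𝓜.univ.baseChange (ε.left ≫ pullback.fst C.𝓜.M.hom (bcSpec ℚ Fi))).relDim c hcc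
    (fun b => Summit.HodgeConjecture.HodgeConjecture.Cruxes.HLiu418.F0P6aStubE6.rosatiOver_of_ringActionReading hτE C ε ρ hR b (c b) (hc b))
    _ _ m₁ m₂ hR₁.2.2.2.1 hR₂.2.2.2.1 hsp₁.1 hsp₂.1 hsp₁.2.2.2.1 hsp₂.2.2.2.1 Λ₁ Λ₂ hR₁.1 hR₂.1 hR₁.2.1 hR₂.2.1 hR₁.2.2.1 hR₂.2.2.1
    (C.Mρ a₁) (C.Mρ a₂) hR₁.2.2.2.2.2 hR₂.2.2.2.2.2 hMJ₁ _ hTu hTJ hTM hTν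
    w.asIdeal ((IsCMField.complexConj F) • w).asIdeal 𝔡 h𝔭c hp hpw w.ne_bot h𝔡.symm hTΛ hTlvl hTΛc

/-- ORGAN (O-R2) **PAID** (L5-#7, LA5-p01 (g4), by copy on v7): `stub_ER2 := stub_ER2_of_MP stub_MP` — the central roofs at complex points from the marked pair organ
`stub_MP` (BY NAME; its (T-Λc) projection under the `i = 2` guard is `hK₂`, (T-lvl) at `p := pChar`) through ★ `exists_heckeCentralRoof_of_markedReadings` (A-p06 (g35) p850307).
[cite: Kottwitz1992, §5 pp. 389–391] [cite: RapoportSmithlingZhang2020Diagonal, §4.3 (4.23) p. 21] -/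
theorem stub_ER2 : OrganER2 := stub_ER2_of_MP stub_MP

set_option maxHeartbeats 400000 in
/-- **(O-C) FROM ITS ORGANS** — `OrganER1 → OrganER2 → OrganEC`, kernel-checked (`heckeRoofsAt_of_lines_of_central` pointwise). [cite: HarrisTaylorAMS2001, §III.4, pp. 108–110] -/
theorem stub_EC_of_organs (h₁ : OrganER1) (h₂ : OrganER2) : OrganEC := by
  intro F _ _ _ _ ι₁ Jstar hJ hJu K₀ S hU7ₛ Kc Fi _ _ _ _ τE hτE Φ hΦ C ξ k Fr hpin ε hε ρ hR w hw hKv hJi pChar fDeg hp hpw hq hpN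
    N' hN'Kc rc₁ hrc₁ hrcN₁ rc₂ hrc₂ hrcN₂ x'c
  letI : Algebra F ℂ := ι₁.toAlgebra
  exact heckeRoofsAt_of_lines_of_central S hU7ₛ hJ hJu Kc w hw _ ρ _ _ _ pChar fDeg (sheetHom ι₁ τE hτE) N' hN'Kc rc₁ hrcN₁ rc₂ hrcN₂ x'c
    (h₁ F ι₁ Jstar hJ hJu K₀ S hU7ₛ Kc Fi τE hτE Φ hΦ C ξ k Fr hpin ε hε ρ hR w hw hKv hJi pChar fDeg hp hpw hq hpN N' hN'Kc rc₁ hrc₁ hrcN₁ x'c)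
    (h₂ F ι₁ Jstar hJ hJu K₀ S hU7ₛ Kc Fi τE hτE Φ hΦ C ξ k Fr hpin ε hε ρ hR w hw hKv hJi pChar fDeg hp hpw hq hpN N' hN'Kc rc₂ hrc₂ hrcN₂ x'c)

/-- **(O-C) ON THIS LINE** := `stub_EC_of_organs stub_ER1 stub_ER2`. -/
theorem organEC_of_line : OrganEC := stub_EC_of_organs stub_ER1 stub_ER2

/-! ### §3 THE HEAD — `stub_EHECKE_of_line : StubEHECKE` PROVED from `organEC_of_line` (= `stub_EC_of_organs stub_ER1 stub_ER2`) + `stub_ET` (the `Fᵢ`-pinned `σ` by ★ p849445 + ★ `exists_ringEquiv_apply_eq`) -/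

set_option maxHeartbeats 400000 in
/-- **THE EHECKE CLOSER HEAD** — the X-leaf letter `RecordEHeckeReading` (= `StubEHECKE`), from the complex-side organ `stub_EC` and the transport organ `stub_ET`: given the
sheet `e′ : Fᵢ →ₐ[F] F̄_w` and the `F̄_w`-point `x′`, choose `σ₀ : F̄_w ≃+* ℂ` over `ι₁` (★ p849445), correct it by an automorphism `θ` of `ℂ` with `θ ∘ σ₀ ∘ e′ = τE` on the
countable field `Fᵢ` (★ `exists_ringEquiv_apply_eq`), put `σ := θ ∘ σ₀`; read the roofs at the complex point `σ_* x′` on the `τE`-sheet (`stub_EC`) and carry them to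
`x′` on the `e′`-sheet (`stub_ET`).  Kernel-checked modulo the two organ stubs. [cite: Liu2021, Lemma C.18 p. 115, Prop. D.8 p. 135] [cite: Lang2002, Ch. VIII §1 and Ch. V §2 Thm. 2.8] -/
theorem stub_EHECKE_of_line : StubEHECKE := by
  intro F _ _ _ _ ι₁ Jstar hJ hJu K₀ S hU7ₛ Kc Fi _ _ _ _ τE hτE Φ hΦ C ξ k Fr hpin ε hε ρ hR w hw hKv hJi pChar fDeg hp hpw hq hpN
  refine heckeRoofsE_of_forall_heckeRoofsAt S hU7ₛ hJ hJu Kc w hw _ ρ _ _ _ pChar fDeg ?_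
  intro e' N' hN'Kc rc₁ hrc₁ hrcN₁ rc₂ hrc₂ hrcN₂ x'
  -- the `Fᵢ`-pinned isomorphism `σ : F̄_w ≃+* ℂ`, `σ ∘ e′ = τE`
  obtain ⟨σ₀, _h₀⟩ :=
    Literature.FieldTheory.AlgClosed.exists_ringEquiv_algebraicClosure_adicCompletion_complex_comp_eq F w ι₁
  have hℂ : Cardinal.aleph0 < Cardinal.mk ℂ := by rw [Cardinal.mk_complex]; exact Cardinal.aleph0_lt_continuum
  have hFi : Cardinal.mk Fi ≤ Cardinal.aleph0 :=
    (Algebra.IsAlgebraic.cardinalMk_le_max ℚ Fi).trans (max_le Cardinal.mk_le_aleph0 le_rfl)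
  obtain ⟨θ, hθ⟩ := Literature.FieldTheory.AlgClosed.exists_ringEquiv_apply_eq hℂ hFi
    ((σ₀ : AlgebraicClosure (w.adicCompletion F) →+* ℂ).comp (e' : Fi →+* AlgebraicClosure (w.adicCompletion F))) τE
  have hσe : ∀ x : Fi, (σ₀.trans θ) (e' x) = τE x := fun x => hθ x
  exact stub_ET F ι₁ Jstar hJ hJu K₀ S hU7ₛ Kc Fi τE hτE _ ρ _ _ _ w hw pChar fDeg (σ₀.trans θ) e' hσe N' hN'Kc rc₁ hrcN₁ rc₂ hrcN₂ x'
    (organEC_of_line F ι₁ Jstar hJ hJu K₀ S hU7ₛ Kc Fi τE hτE Φ hΦ C ξ k Fr hpin ε hε ρ hR w hw hKv hJi pChar fDeg hp hpw hq hpN N' hN'Kc rc₁ hrc₁ hrcN₁ rc₂ hrc₂ hrcN₂ _)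

end Summit.HodgeConjecture.HodgeConjecture.Cruxes.HLiu418.F0P6aStubEHECKE

end
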